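import Summits.QuantumFields.YangMills.Theorems.BalabanLadderIRColdDoublingRecursionSC
import Literature.MathematicalPhysics.QuantumLattice.LatticeGaugeDLRFreeEnergyProofs
import HarnessLib

/-!
# Cruxes/IR — line `pressure-monotone-tm` (ideator `ym-ir-idea-5` g7, lens: chessboard / RP transfer-matrix bounds)

Landed for item `stmt-QuantumFields-19354` (`--supports … --as helper`) by the LEAD prover ab-p1 under director-ym RULING g9-№2 ∕ №14 (3)
(critic ym-ir-crit-2 03:04:13Z ∕ 03:14:37Z: PASS as supplier); authored by ideator ym-ir-idea-5 g7, split of the sorry-free workfile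
`Cruxes/IR/Lines/pressure_monotone_tm.lean` v5 (Part B = `Cruxes/IR/Lines/rp_doubling.lean`) per `Cruxes/IR/Lines/pressure_monotone_tm_LANDING.md`
(eight files: `SiteRPGeometry` → `SiteRPDoubling` → `SiteRPZdBoxes` → `SiteRPFreeCubeDoubling`; `PressureMonotoneTMFloor` → `…LinearFloor` → `…LogFloor` → `…Equipartition`).
This file: the package docstring (below) + §1 abstract slot monotonicity + §2 the exact transfer-matrix FLOOR `L⁴ f(β) ≤ log Z_{Λ_L,β}` (all `L ≥ 2`, `β ≥ 0`) + §3 consequences.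

SUPPLIER, PROVED (`lean check` rc 0, no `sorry`; the `def`s are bookkeeping `Prop`s — a verbatim mirror of idea-4's
`FreeEnergyIncrementFrom`, the classical multiple-reflection bound `FreeCubeRPDoubling[All]` of §5 (Glimm–Jaffe
Prop. 10.5.1 for the product Haar measure — typed in §5 and PROVED in Part B / §6 of this v3, so that every
statement below is now UNCONDITIONAL) — and the floor functions `linFloor`, `logFloor`, `iterSide`):
**the torus pressure of Wilson's lattice gauge theory is non-increasing in the period, in every axis, with
no error term**, hence **the finite torus free energy is bounded BELOW by the infinite-volume free energy
density times the volume, for EVERY side `L ≥ 2` and every `β ≥ 0`**; and (§4) **a ceiling with cost on the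
BOUNDARY only, `log Z_{Λ_L,β} ≤ L⁴ f(β) + C_r β L³`, whence the free-energy increment (FE) of the large-field
rarity engine above the LINEAR volume floor `L ≥ ⌈β⌉₊ + 2`** (idea-4 g3: quadratic floor `(⌈β⌉₊+2)²`):

* `slot3_mul_log_le` … `slot2_mul_log_le` (abstract, §1): for an axis-symmetric family `Z : ℕ⁴ → ℝ` that is
  trace-positive in the last slot for every spatial box, `n · log Z(…, n', …) ≤ n' · log Z(…, n, …)` in each of
  the four slots, `2 ≤ n ≤ n'` — the `ℓᵖ`-monotonicity `‖λ‖_{n'} ≤ ‖λ‖_{n}` of the (non-negative, Lüscher)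
  transfer-matrix spectrum (tree `AspectBootstrap.mul_log_le`), transported to every axis by the three
  transpositions of `IsAxisSymmetric`;
* `cube_mul_log_le`: `L⁴ · log Z(L',L',L',L') ≤ L'⁴ · log Z(L,L,L,L)` for `2 ≤ L ≤ L'`;
  `box_mul_log_le`: `n₀n₁n₂n₃ · log Z(M,M,M,M) ≤ M⁴ · log Z(n₀,n₁,n₂,n₃)` for `2 ≤ nᵢ ≤ M`;
* (§2, Wilson's model, every compact `G`, every lattice representation `r`, `β ≥ 0`)
  `torusPressure_antitone`: `L ↦ L⁻⁴ log Z_{Λ_L,β}` is non-increasing on `L ≥ 2`;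
  `volume_mul_le_torusLogPartition` / `volume_mul_freeEnergyDensity_le_torusLogPartition`:
  **`L⁴ · f(β) ≤ log Z_{Λ_L,β}` for all `L ≥ 2`** (`f` = the tree's `freeEnergyDensity 4 r.ρ β`, which exists by
  `exists_hasFreeEnergyDensity_holds`); the anisotropic form `boxVolume_mul_freeEnergyDensity_le_log`:
  `n₀n₁n₂n₃ · f(β) ≤ log Z_{r,β}(n₀,n₁,n₂,n₃)` (all sides `≥ 2`); and the spectral form
  `spatialVolume_mul_freeEnergyDensity_le_phi`: `b₁b₂b₃ · f(β) ≤ φ(b₁,b₂,b₃) = log λ₀` — the ground-state energy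
  per site of the spatial torus `b₁ × b₂ × b₃` is at most `−f(β)`;
* (§3, consequences for the `BalabanLadder.IR` bookkeeping) `uniform_floor_of_tendsto`: any asymptotic
  `f(β) + c log β → K` (Chatterjee: `c = 3N²/2` for `U(N)`, tree `SoloBlind.tendsto_freeEnergyDensity_add_log`;
  `c = 3 dim G/2` expected in general) yields the **β-UNIFORM SHARP FLOOR `log Z_{Λ_L,β} ≥ L⁴ (K − ε − c log β)`
  for ALL `L ≥ 2` and all `β ≥ β_ε`, with NO volume floor** — replacing the crude link-ball floors of the tree
  (`torusLogPartition_lower_rep`: coefficient `2·dimE·L⁴` of `log β`, constant `−48L⁴`) by the sharp Gaussian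
  coefficient; `increment_le_excess_add`: the free-energy increment of the large-field rarity engine satisfies
  `log Z_L(β') − log Z_L(β) ≤ [log Z_L(β') − L⁴ f(β')] + L⁴ (f(β') − f(β))` for all `L ≥ 2` — the FLOOR half of the
  finite-size sandwich `FiniteSizeFreeEnergy` of `Lines/largefield_rarity_chessboard.lean` (idea-4 g3) and of
  `Lines/largefield_rarity_uniform.lean` (this seat, g6) is now exact and β-free; only the CEILING half carries a
  volume floor;
* (§4, the ceiling and the LINEAR floor) `torusLogPartition_le_freeBox`: `log Z_{Λ_{n+1},β} ≤ (n+1)⁴ f(β) +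
  10·β(N+M)·#planes·(n+1)³` (one free cube inside the torus: the tree's sub-box estimate at `q = 1`, subset
  monotonicity of the Boltzmann weight at `β ≥ 0`, Chatterjee's Lemma 17.5 `ChatterjeeFreeEnergy.le_freeEnergyDensity`);
  `finiteSize_linear`: `L⁴ f(β) ≤ log Z_{Λ_L,β} ≤ L⁴ f(β) + C_r β L³` for all `β ≥ 0`, `L ≥ 2`;
  `increment_bound_of_tendsto`: from ANY asymptotic `f(β) + c log β → K`, `log Z_L(β') − log Z_L(β) ≤ c L⁴ log(β/β') +
  C L⁴` for `β₃ ≤ β' ≤ β` and `L ≥ linFloor β = ⌈β⌉₊ + 2`; `freeEnergyIncrementFrom_linFloor :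
  FreeEnergyIncrementFrom linFloor` — idea-4's (FE) `Prop` (mirrored verbatim) PROVED above the linear floor for every
  compact simple `G` (tree `freeEnergyLogCoefficient_proof`).  Fed to idea-4's proved floor-parametric engine
  `largeFieldRarityOn_of_ZRatio chessboardZRatio_odd : FreeEnergyIncrementFrom fl → LargeFieldRarityOnFrom {odd ≥ 3} fl`
  it yields β-uniform Peierls-multiplicative large-field rarity on all odd tori `2S+1 ≥ ⌈β⌉₊ + 2`; the residual
  `LargeFieldRaritySmallTori` shrinks from `2S+1 < (⌈β⌉₊+2)²` to `2S+1 ≤ ⌈β⌉₊ + 1`;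
* (§5, the LOGARITHMIC floor by MULTIPLE REFLECTIONS — Glimm–Jaffe §10.5 transplanted to the free Wilson cubes)
  `FreeCubeRPDoubling ρ β` (typed): `Z(B_m)^{16} ≤ Z(B_{2m−1})`, `m ≥ 1` (site-reflection positivity of the product Haar
  measure, four Schwarz inequalities = GJ Prop. 10.5.1 with `k` = the half-face-weighted cube weight);
  PROVED from it: `log_freeCube_le_of_doubling`: `log Z(B_m) ≤ (m−1)⁴ f(β)` (NO β-cost; exact in `d = 2`);
  `torusLogPartition_le_log_freeCube` (unconditional, one-sided periodisation at no cost): `log Z_{Λ_{n+2},β} ≤ log Z(B_{n+1})`;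
  `torusLogPartition_le_of_doubling`: `log Z_{Λ_L,β} ≤ (L−2)⁴ f(β)`; `increment_bound_log_of_tendsto` and
  `freeEnergyIncrementFrom_logFloor : FreeCubeRPDoublingAll → FreeEnergyIncrementFrom logFloor`, `logFloor β = ⌈log β⌉₊ + 2`:
  (FE), hence idea-4's β-uniform rarity, on all odd tori `2S+1 ≥ ⌈log β⌉₊ + 2` — the residual shrinks to `2S+1 ≤ ⌈log β⌉₊+1`,
  i.e. `L⁴ ≲ (log β)⁴`, next to the toron regime `L⁴ ≲ log β` where the β-uniform ceiling is false;
* (Part B = `Lines/rp_doubling.lean` verbatim, namespace `…Cruxes.IR.RPDoubling`, §B1–§B5; duplicated here only because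
  Cruxes workfiles cannot import one another on the farm — land it as its own module and replace Part B by an `import`)
  **reflection positivity of the product Haar measure in lattice HYPERPLANES THROUGH SITES** (`x_i = c` on the torus
  `(ℤ/L)^d`, `Θ` inverting the links of direction `i`; `measurePreserving_configReflect`, the Schwarz inequality
  `sq_integral_prod_tw_le : (∫ ∏_{p∈A} e^{−βS_p})² ≤ ∫ ∏_{p ∈ A ∪ θ(A∖faces)} e^{−βS_p}` for upper plaquette sets `A` of
  range `2H < L`, via the tree's abstract site-RP Cauchy–Schwarz `LatticeRP.re_sum_pair_sq_le` with half weights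
  `e^{−βS_p/2}` on the face plaquettes), its transfer to `ℤ^d` (`zdZ_sq_le_zdZ_zDouble`, through
  `FreeEnergy.integral_torusWeight_image`), the box combinatorics `zDouble_boxPlaqs` (a box reflected in its bottom face is
  the doubled box) and `d` successive reflections `zdZ_boxPlaqs_pow_le`, whence **`zdZ_cubePlaqs_pow_le :
  Z([0,m)^d)^(2^d) ≤ Z([0,2m−1)^d)`** for every `d`, every compact `G`, every continuous `ρ` with `Re tr ρ ≤ N`, every
  `β ≥ 0`, `m ≥ 1`, and `zdPartitionFunction_halfOpenBox_pow_sixteen_le` (`d = 4`);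
* (§6) `freeCubeRPDoublingAll_holds : FreeCubeRPDoublingAll` and **`freeEnergyIncrementFrom_logFloor_holds :
  FreeEnergyIncrementFrom logFloor` — (FE) above the LOGARITHMIC volume floor `⌈log β⌉₊ + 2`, unconditionally.**

WHY THIS IS THE LENS: reflection positivity in all four axes (Osterwalder–Seiler) = a positive self-adjoint
Hilbert–Schmidt transfer matrix in every direction (tree `exists_spectralData_wilsonFinTorusPartition_box`,
`posType_finTorusSliceKernel`); `Z = Tr 𝕋ⁿ = Σ λᵢⁿ` with `λᵢ ≥ 0` makes `(log Z(n))/n = log ‖λ‖ₙ` non-increasing in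
`n`.  Nothing model-specific enters: the floor holds for `U(1)` as well (it carries NO Yang–Mills difficulty).

WHAT IT DOES NOT DO (honesty clause).  Nothing here proves the Yang–Mills mass gap (Clay), `BalabanLadder.IR`
(item 19354), a lattice gap, or `BalabanLadder.NT`; `R4` closes only the conditional finite-`𝕋⁴` rung
`BalabanLadder.UV`.  The proved ceiling costs `β` per boundary plaquette (`C_r β L³`), which is why the floor is linear; the
β-UNIFORM ceiling `log Z_{Λ_L,β} ≤ L⁴ f(β) + C·L⁴` below that floor is NOT proved and is in fact expected to be FALSE on
tori with `L⁴ ≪ log β`: the flat connections (torons; commuting quadruples in a maximal torus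
of `G`, `3·rank G` extra flat directions modulo gauge) give `log Z_{Λ_L,β} − L⁴ f(β) ≳ (3 rank G/2)·log β − C_L → ∞`
at fixed `L`.  So the floor-free residual `stub_largeFieldRaritySmallTori` of `Lines/smallfield_polymer_coder.lean`
must keep the DIFFERENCE form `[log Z_L(β') − L⁴f(β')] − [log Z_L(β) − L⁴f(β)] ≤ C L⁴` (excess increment), in which
the toron logarithms cancel; this file discharges every FLOOR that bookkeeping needs, the ceiling down to `L ≈ β`, and
isolates the excess increment on the tori `2 ≤ L ≤ ⌈β⌉₊ + 1` as the one remaining finite-size input (a Gaussian-accuracy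
gluing — interface cost `O(log β)` instead of `O(β)` per boundary plaquette — would lower the floor to `L ≈ log β`; below
`L⁴ ≈ log β` only a torus-intrinsic toron analysis can decide it).  See the card `Lines/pressure-monotone-tm.md`.

References: M. Lüscher, Commun. Math. Phys. 54 (1977) 283 (positivity of the transfer matrix); K. Osterwalder,
E. Seiler, Ann. Phys. 110 (1978) 440 (reflection positivity in all axes); I. Montvay, G. Münster, *Quantum Fields on
a Lattice* (1994) §3.2.6 (3.145) (`Z = Tr 𝕋ᴺ`); S. Chatterjee, arXiv:1602.01222, Thm. 2.1 (leading term of `f`);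
S. Friedli, Y. Velenik (2017) Thm. 3.6 (existence of the pressure).
-/

noncomputable section

open scoped Topology
open Filter MeasureTheory
open Literature.MathematicalPhysics.QuantumFieldTheory Literature.MathematicalPhysics.QuantumLattice
open Summit.QuantumFields.YangMills.Cruxes.IR.AspectBootstrap (HasSpectralDatum IsAxisSymmetric mul_log_le phi
  phi_ge_of_lower axisSymmetric)

namespace Summit.QuantumFields.YangMills.Cruxes.IR.PressureMonotoneTM

/-! ## §1 Abstract: slot-wise period monotonicity for axis-symmetric trace-positive families -/

section Abstract

variable {Z : ℕ → ℕ → ℕ → ℕ → ℝ}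

/-- [TM, all boxes] trace positivity in the last slot for EVERY spatial box (no side restriction; this is what the
tree's anisotropic trace formula actually gives for Wilson's action, cf. `AspectBootstrap.tracePositive`). -/
def IsTracePositiveAll (Z : ℕ → ℕ → ℕ → ℕ → ℝ) : Prop :=
  ∀ b₁ b₂ b₃ : ℕ, HasSpectralDatum (Z b₁ b₂ b₃)

/-- slot 3: `n · log Z(b₁,b₂,b₃,n') ≤ n' · log Z(b₁,b₂,b₃,n)` for `2 ≤ n ≤ n'` (`‖λ‖_{n'} ≤ ‖λ‖ₙ`). -/
theorem slot3_mul_log_le (hT : IsTracePositiveAll Z) (b₁ b₂ b₃ : ℕ) {n n' : ℕ} (hn : 2 ≤ n)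
    (hnn' : n ≤ n') : (n : ℝ) * Real.log (Z b₁ b₂ b₃ n') ≤ (n' : ℝ) * Real.log (Z b₁ b₂ b₃ n) := by
  obtain ⟨a, rfl⟩ : ∃ a, n = a + 2 := ⟨n - 2, by omega⟩
  obtain ⟨a', rfl⟩ : ∃ a', n' = a' + 2 := ⟨n' - 2, by omega⟩
  exact mul_log_le (hT b₁ b₂ b₃) (show a ≤ a' by omega)

/-- slot 0 (transposition `(0 3)`): `n · log Z(n',b,c,d) ≤ n' · log Z(n,b,c,d)` for `2 ≤ n ≤ n'`. -/
theorem slot0_mul_log_le (hS : IsAxisSymmetric Z) (hT : IsTracePositiveAll Z) (b c d : ℕ) {n n' : ℕ}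
    (hn : 2 ≤ n) (hnn' : n ≤ n') : (n : ℝ) * Real.log (Z n' b c d) ≤ (n' : ℝ) * Real.log (Z n b c d) := by
  rw [(hS n' b c d).1, (hS n b c d).1]
  exact slot3_mul_log_le hT d b c hn hnn'

/-- slot 1 (transposition `(0 1)`): `n · log Z(a,n',c,d) ≤ n' · log Z(a,n,c,d)` for `2 ≤ n ≤ n'`. -/
theorem slot1_mul_log_le (hS : IsAxisSymmetric Z) (hT : IsTracePositiveAll Z) (a c d : ℕ) {n n' : ℕ}
    (hn : 2 ≤ n) (hnn' : n ≤ n') : (n : ℝ) * Real.log (Z a n' c d) ≤ (n' : ℝ) * Real.log (Z a n c d) := by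
  rw [(hS a n' c d).2.1, (hS a n c d).2.1]
  exact slot0_mul_log_le hS hT a c d hn hnn'

/-- slot 2 (transposition `(0 2)`): `n · log Z(a,b,n',d) ≤ n' · log Z(a,b,n,d)` for `2 ≤ n ≤ n'`. -/
theorem slot2_mul_log_le (hS : IsAxisSymmetric Z) (hT : IsTracePositiveAll Z) (a b d : ℕ) {n n' : ℕ}
    (hn : 2 ≤ n) (hnn' : n ≤ n') : (n : ℝ) * Real.log (Z a b n' d) ≤ (n' : ℝ) * Real.log (Z a b n d) := by
  rw [(hS a b n' d).2.2, (hS a b n d).2.2]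
  exact slot0_mul_log_le hS hT b a d hn hnn'

/-- **Cube monotonicity**: `L⁴ · log Z(L',L',L',L') ≤ L'⁴ · log Z(L,L,L,L)` for `2 ≤ L ≤ L'` — the pressure
`L⁻⁴ log Z(L⁴)` is non-increasing in the period. -/
theorem cube_mul_log_le (hS : IsAxisSymmetric Z) (hT : IsTracePositiveAll Z) {L L' : ℕ} (hL : 2 ≤ L)
    (hLL' : L ≤ L') :
    (L : ℝ) ^ 4 * Real.log (Z L' L' L' L') ≤ (L' : ℝ) ^ 4 * Real.log (Z L L L L) := by
  have h0 := slot0_mul_log_le hS hT L' L' L' hL hLL'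
  have h1 := slot1_mul_log_le hS hT L L' L' hL hLL'
  have h2 := slot2_mul_log_le hS hT L L L' hL hLL'
  have h3 := slot3_mul_log_le hT L L L hL hLL'
  have hL0 : (0 : ℝ) ≤ L := Nat.cast_nonneg L
  have hL'0 : (0 : ℝ) ≤ L' := Nat.cast_nonneg L'
  calc (L : ℝ) ^ 4 * Real.log (Z L' L' L' L')
      = (L : ℝ) ^ 3 * ((L : ℝ) * Real.log (Z L' L' L' L')) := by ring
    _ ≤ (L : ℝ) ^ 3 * ((L' : ℝ) * Real.log (Z L L' L' L')) := mul_le_mul_of_nonneg_left h0 (by positivity)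
    _ = (L : ℝ) ^ 2 * L' * ((L : ℝ) * Real.log (Z L L' L' L')) := by ring
    _ ≤ (L : ℝ) ^ 2 * L' * ((L' : ℝ) * Real.log (Z L L L' L')) := mul_le_mul_of_nonneg_left h1 (by positivity)
    _ = (L : ℝ) * (L' : ℝ) ^ 2 * ((L : ℝ) * Real.log (Z L L L' L')) := by ring
    _ ≤ (L : ℝ) * (L' : ℝ) ^ 2 * ((L' : ℝ) * Real.log (Z L L L L')) := mul_le_mul_of_nonneg_left h2 (by positivity)
    _ = (L' : ℝ) ^ 3 * ((L : ℝ) * Real.log (Z L L L L')) := by ring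
    _ ≤ (L' : ℝ) ^ 3 * ((L' : ℝ) * Real.log (Z L L L L)) := mul_le_mul_of_nonneg_left h3 (by positivity)
    _ = (L' : ℝ) ^ 4 * Real.log (Z L L L L) := by ring

/-- **Box monotonicity**: `n₀n₁n₂n₃ · log Z(M,M,M,M) ≤ M⁴ · log Z(n₀,n₁,n₂,n₃)` whenever `2 ≤ nᵢ ≤ M`. -/
theorem box_mul_log_le (hS : IsAxisSymmetric Z) (hT : IsTracePositiveAll Z) {n₀ n₁ n₂ n₃ M : ℕ}
    (h₀ : 2 ≤ n₀) (h₁ : 2 ≤ n₁) (h₂ : 2 ≤ n₂) (h₃ : 2 ≤ n₃) (h₀M : n₀ ≤ M) (h₁M : n₁ ≤ M) (h₂M : n₂ ≤ M)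
    (h₃M : n₃ ≤ M) :
    ((n₀ : ℝ) * n₁ * n₂ * n₃) * Real.log (Z M M M M) ≤ (M : ℝ) ^ 4 * Real.log (Z n₀ n₁ n₂ n₃) := by
  have g0 := slot0_mul_log_le hS hT M M M h₀ h₀M
  have g1 := slot1_mul_log_le hS hT n₀ M M h₁ h₁M
  have g2 := slot2_mul_log_le hS hT n₀ n₁ M h₂ h₂M
  have g3 := slot3_mul_log_le hT n₀ n₁ n₂ h₃ h₃M
  have hM0 : (0 : ℝ) ≤ M := Nat.cast_nonneg M
  have e0 : (0 : ℝ) ≤ n₀ := Nat.cast_nonneg n₀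
  have e1 : (0 : ℝ) ≤ n₁ := Nat.cast_nonneg n₁
  have e2 : (0 : ℝ) ≤ n₂ := Nat.cast_nonneg n₂
  have e3 : (0 : ℝ) ≤ n₃ := Nat.cast_nonneg n₃
  calc ((n₀ : ℝ) * n₁ * n₂ * n₃) * Real.log (Z M M M M)
      = ((n₁ : ℝ) * n₂ * n₃) * ((n₀ : ℝ) * Real.log (Z M M M M)) := by ring
    _ ≤ ((n₁ : ℝ) * n₂ * n₃) * ((M : ℝ) * Real.log (Z n₀ M M M)) := mul_le_mul_of_nonneg_left g0 (by positivity)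
    _ = ((M : ℝ) * n₂ * n₃) * ((n₁ : ℝ) * Real.log (Z n₀ M M M)) := by ring
    _ ≤ ((M : ℝ) * n₂ * n₃) * ((M : ℝ) * Real.log (Z n₀ n₁ M M)) := mul_le_mul_of_nonneg_left g1 (by positivity)
    _ = ((M : ℝ) ^ 2 * n₃) * ((n₂ : ℝ) * Real.log (Z n₀ n₁ M M)) := by ring
    _ ≤ ((M : ℝ) ^ 2 * n₃) * ((M : ℝ) * Real.log (Z n₀ n₁ n₂ M)) := mul_le_mul_of_nonneg_left g2 (by positivity)
    _ = (M : ℝ) ^ 3 * ((n₃ : ℝ) * Real.log (Z n₀ n₁ n₂ M)) := by ring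
    _ ≤ (M : ℝ) ^ 3 * ((M : ℝ) * Real.log (Z n₀ n₁ n₂ n₃)) := mul_le_mul_of_nonneg_left g3 (by positivity)
    _ = (M : ℝ) ^ 4 * Real.log (Z n₀ n₁ n₂ n₃) := by ring

end Abstract

/-! ## §2 Wilson's model: the torus pressure is non-increasing in `L`, hence `L⁴ f(β) ≤ log Z_{Λ_L,β}` -/

section Model

variable {G : Type} [Group G] [TopologicalSpace G] [IsTopologicalGroup G] [CompactSpace G]
  [MeasurableSpace G] [BorelSpace G]

/-- [TM, all boxes] for the model (the tree's anisotropic trace formula `exists_spectralData_wilsonFinTorusPartition_box`,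
exactly as in `AspectBootstrap.tracePositive` but without the unused side hypotheses). -/
theorem tracePositiveAll (r : LatticeRep G) {β : ℝ} (hβ : 0 ≤ β) :
    IsTracePositiveAll (wilsonFinTorusPartition r.ρ β) := by
  haveI : SecondCountableTopology G :=
    (r.continuous.isClosedEmbedding r.injective).isEmbedding.secondCountableTopology
  intro b₁ b₂ b₃
  obtain ⟨s, _, lam, i₀, hle, hpos, -, hZ⟩ :=
    exists_spectralData_wilsonFinTorusPartition_box r.continuous r.mem_unitary hβ b₁ b₂ b₃
  exact ⟨s, lam, i₀, hle, hpos, hZ⟩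

/-- Dictionary: `log Z_{Λ_L,β}` (`torusLogPartition 4`) is `log Z_{r,β}(L,L,L,L)`. -/
theorem torusLogPartition_eq_log (r : LatticeRep G) (β : ℝ) (L : ℕ) [NeZero L] :
    torusLogPartition 4 r.ρ β L = Real.log (wilsonFinTorusPartition r.ρ β L L L L) := by
  haveI : SecondCountableTopology G :=
    (r.continuous.isClosedEmbedding r.injective).isEmbedding.secondCountableTopology
  rw [torusLogPartition, toReal_partitionFunction_eq_wilsonFinTorusPartition r.continuous β]

/-- **Period monotonicity of the torus free energy**: `L⁴ · log Z_{Λ_{L'},β} ≤ L'⁴ · log Z_{Λ_L,β}` for `β ≥ 0` and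
`2 ≤ L ≤ L'`, every compact `G`, every lattice representation. -/
theorem torusLogPartition_mul_le (r : LatticeRep G) {β : ℝ} (hβ : 0 ≤ β) {L L' : ℕ} [NeZero L] [NeZero L']
    (hL : 2 ≤ L) (hLL' : L ≤ L') :
    (L : ℝ) ^ 4 * torusLogPartition 4 r.ρ β L' ≤ (L' : ℝ) ^ 4 * torusLogPartition 4 r.ρ β L := by
  rw [torusLogPartition_eq_log r β L, torusLogPartition_eq_log r β L']
  exact cube_mul_log_le (axisSymmetric r β) (tracePositiveAll r hβ) hL hLL'

/-- **The torus pressure `L⁻⁴ log Z_{Λ_L,β}` is non-increasing on `L ≥ 2`** (`β ≥ 0`). -/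
theorem torusPressure_antitone (r : LatticeRep G) {β : ℝ} (hβ : 0 ≤ β) {L L' : ℕ} [NeZero L] [NeZero L']
    (hL : 2 ≤ L) (hLL' : L ≤ L') :
    torusLogPartition 4 r.ρ β L' / (L' : ℝ) ^ 4 ≤ torusLogPartition 4 r.ρ β L / (L : ℝ) ^ 4 := by
  have h := torusLogPartition_mul_le r hβ hL hLL'
  have hL0 : (0 : ℝ) < (L : ℝ) ^ 4 := by positivity
  have hL'0 : (0 : ℝ) < (L' : ℝ) ^ 4 := by
    have : (0 : ℝ) < L' := by exact_mod_cast (show 0 < L' by omega)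
    positivity
  rw [div_le_div_iff₀ hL'0 hL0]
  linarith

/-- **Floor by the free energy density, ALL `L ≥ 2`**: if `L⁻⁴ log Z_{Λ_L,β} → f` then `L⁴ · f ≤ log Z_{Λ_L,β}` for
every `L ≥ 2` (`β ≥ 0`) — no volume floor, no error term. -/
theorem volume_mul_le_torusLogPartition (r : LatticeRep G) {β f : ℝ} (hβ : 0 ≤ β)
    (hf : HasFreeEnergyDensity 4 r.ρ β f) (L : ℕ) [NeZero L] (hL : 2 ≤ L) :
    (L : ℝ) ^ 4 * f ≤ torusLogPartition 4 r.ρ β L := by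
  have hL0 : (0 : ℝ) < (L : ℝ) ^ 4 := by positivity
  have key : ∀ᶠ n : ℕ in atTop, (((n + 1 : ℕ) : ℝ) ^ 4)⁻¹ * torusLogPartition 4 r.ρ β (n + 1) ≤
      torusLogPartition 4 r.ρ β L / (L : ℝ) ^ 4 := by
    filter_upwards [eventually_ge_atTop L] with n hn
    have h := torusLogPartition_mul_le r hβ (L := L) (L' := n + 1) hL (by omega)
    have hn0 : (0 : ℝ) < ((n + 1 : ℕ) : ℝ) ^ 4 := by positivity
    rw [inv_mul_eq_div, div_le_div_iff₀ hn0 hL0]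
    linarith
  have hlim : f ≤ torusLogPartition 4 r.ρ β L / (L : ℝ) ^ 4 := le_of_tendsto hf key
  rw [le_div_iff₀ hL0] at hlim
  linarith

/-- **`L⁴ · f(β) ≤ log Z_{Λ_L,β}` for all `L ≥ 2`, `β ≥ 0`**, with `f = freeEnergyDensity 4 r.ρ β` (which exists,
`exists_hasFreeEnergyDensity_holds`). -/
theorem volume_mul_freeEnergyDensity_le_torusLogPartition (r : LatticeRep G) {β : ℝ} (hβ : 0 ≤ β) (L : ℕ)
    [NeZero L] (hL : 2 ≤ L) :
    (L : ℝ) ^ 4 * freeEnergyDensity 4 r.ρ β ≤ torusLogPartition 4 r.ρ β L := by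
  haveI : SecondCountableTopology G :=
    (r.continuous.isClosedEmbedding r.injective).isEmbedding.secondCountableTopology
  obtain ⟨f, hf⟩ := exists_hasFreeEnergyDensity_holds (d := 4) r.ρ r.continuous β
  rw [hf.freeEnergyDensity_eq]
  exact volume_mul_le_torusLogPartition r hβ hf L hL

/-- pressure form: `f(β) ≤ L⁻⁴ log Z_{Λ_L,β}`, `L ≥ 2`, `β ≥ 0`. -/
theorem freeEnergyDensity_le_torusPressure (r : LatticeRep G) {β : ℝ} (hβ : 0 ≤ β) (L : ℕ) [NeZero L]
    (hL : 2 ≤ L) : freeEnergyDensity 4 r.ρ β ≤ torusLogPartition 4 r.ρ β L / (L : ℝ) ^ 4 := by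
  have h := volume_mul_freeEnergyDensity_le_torusLogPartition r hβ L hL
  rw [le_div_iff₀ (by positivity : (0 : ℝ) < (L : ℝ) ^ 4)]
  linarith

/-- **Anisotropic floor**: `n₀n₁n₂n₃ · f(β) ≤ log Z_{r,β}(n₀,n₁,n₂,n₃)` for every box with all sides `≥ 2`
(`β ≥ 0`). -/
theorem boxVolume_mul_freeEnergyDensity_le_log (r : LatticeRep G) {β : ℝ} (hβ : 0 ≤ β) {n₀ n₁ n₂ n₃ : ℕ}
    (h₀ : 2 ≤ n₀) (h₁ : 2 ≤ n₁) (h₂ : 2 ≤ n₂) (h₃ : 2 ≤ n₃) :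
    ((n₀ : ℝ) * n₁ * n₂ * n₃) * freeEnergyDensity 4 r.ρ β ≤
      Real.log (wilsonFinTorusPartition r.ρ β n₀ n₁ n₂ n₃) := by
  set M : ℕ := n₀ + n₁ + n₂ + n₃ with hM
  haveI : NeZero M := ⟨by omega⟩
  have hbox := box_mul_log_le (axisSymmetric r β) (tracePositiveAll r hβ) h₀ h₁ h₂ h₃
    (show n₀ ≤ M by omega) (show n₁ ≤ M by omega) (show n₂ ≤ M by omega) (show n₃ ≤ M by omega)
  have hfloor := volume_mul_freeEnergyDensity_le_torusLogPartition r hβ M (by omega)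
  rw [torusLogPartition_eq_log r β M] at hfloor
  have hM0 : (0 : ℝ) < (M : ℝ) ^ 4 := by
    have : (0 : ℝ) < M := by exact_mod_cast (show 0 < M by omega)
    positivity
  have hV : (0 : ℝ) ≤ (n₀ : ℝ) * n₁ * n₂ * n₃ := by positivity
  -- `V f = (V/M⁴) (M⁴ f) ≤ (V/M⁴) log Z(M⁴) ≤ log Z(n)`
  have h1 : ((n₀ : ℝ) * n₁ * n₂ * n₃) * ((M : ℝ) ^ 4 * freeEnergyDensity 4 r.ρ β) ≤
      ((n₀ : ℝ) * n₁ * n₂ * n₃) * Real.log (wilsonFinTorusPartition r.ρ β M M M M) :=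
    mul_le_mul_of_nonneg_left hfloor hV
  nlinarith [h1, hbox, hM0]

/-- **Spectral form**: `b₁b₂b₃ · f(β) ≤ φ(b₁,b₂,b₃) = log λ₀(b₁,b₂,b₃)` — the ground-state energy per site
`−φ/(b₁b₂b₃)` of the transfer matrix of the spatial torus `b₁ × b₂ × b₃` (sides `≥ 2`) is at most `−f(β)`. -/
theorem spatialVolume_mul_freeEnergyDensity_le_phi (r : LatticeRep G) {β : ℝ} (hβ : 0 ≤ β) {b₁ b₂ b₃ : ℕ}
    (h₁ : 2 ≤ b₁) (h₂ : 2 ≤ b₂) (h₃ : 2 ≤ b₃) :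
    ((b₁ : ℝ) * b₂ * b₃) * freeEnergyDensity 4 r.ρ β ≤ phi (wilsonFinTorusPartition r.ρ β b₁ b₂ b₃) := by
  have h := phi_ge_of_lower (tracePositiveAll r hβ b₁ b₂ b₃) (-(((b₁ : ℝ) * b₂ * b₃) * freeEnergyDensity 4 r.ρ β))
    fun m => by
      have hm := boxVolume_mul_freeEnergyDensity_le_log r hβ h₁ h₂ h₃ (show 2 ≤ m + 2 by omega)
      push_cast at hm ⊢
      nlinarith [hm]
  simpa using h

end Model

/-! ## §3 Consequences for the `BalabanLadder.IR` bookkeeping -/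

section Consequences

variable {G : Type} [Group G] [TopologicalSpace G] [IsTopologicalGroup G] [CompactSpace G]
  [MeasurableSpace G] [BorelSpace G]

/-- **β-uniform sharp floor from a free-energy asymptotic.**  If `f(β) + c·log β → K` as `β → ∞` (Chatterjee's
theorem: `c = 3N²/2` for `U(N)`, tree `SoloBlind.tendsto_freeEnergyDensity_add_log`), then for every `ε > 0`, for
all large `β` and ALL `L ≥ 2`: `L⁴ (K − ε − c log β) ≤ log Z_{Λ_L,β}` — no volume floor. -/
theorem uniform_floor_of_tendsto (r : LatticeRep G) {c K : ℝ}
    (hK : Tendsto (fun β : ℝ => freeEnergyDensity 4 r.ρ β + c * Real.log β) atTop (𝓝 K)) {ε : ℝ}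
    (hε : 0 < ε) :
    ∀ᶠ β : ℝ in atTop, ∀ (L : ℕ) [NeZero L], 2 ≤ L →
      (L : ℝ) ^ 4 * (K - ε - c * Real.log β) ≤ torusLogPartition 4 r.ρ β L := by
  have h1 : ∀ᶠ β : ℝ in atTop, K - ε < freeEnergyDensity 4 r.ρ β + c * Real.log β :=
    hK.eventually (Ioi_mem_nhds (by linarith))
  filter_upwards [h1, eventually_ge_atTop (0 : ℝ)] with β hβK hβ0 L _ hL
  have hfloor := volume_mul_freeEnergyDensity_le_torusLogPartition r hβ0 L hL
  have hL0 : (0 : ℝ) ≤ (L : ℝ) ^ 4 := by positivity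
  have h2 : (L : ℝ) ^ 4 * (K - ε - c * Real.log β) ≤ (L : ℝ) ^ 4 * freeEnergyDensity 4 r.ρ β :=
    mul_le_mul_of_nonneg_left (by linarith) hL0
  linarith

/-- **Increment ≤ excess + density increment** (floor half of the finite-size sandwich, exact and β-free): for
`β ≥ 0`, any `β'`, all `L ≥ 2`,
`log Z_L(β') − log Z_L(β) ≤ [log Z_L(β') − L⁴ f(β')] + L⁴ (f(β') − f(β))`. -/
theorem increment_le_excess_add (r : LatticeRep G) {β : ℝ} (hβ : 0 ≤ β) (β' : ℝ) (L : ℕ) [NeZero L]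
    (hL : 2 ≤ L) :
    torusLogPartition 4 r.ρ β' L - torusLogPartition 4 r.ρ β L ≤
      (torusLogPartition 4 r.ρ β' L - (L : ℝ) ^ 4 * freeEnergyDensity 4 r.ρ β') +
        (L : ℝ) ^ 4 * (freeEnergyDensity 4 r.ρ β' - freeEnergyDensity 4 r.ρ β) := by
  have h := volume_mul_freeEnergyDensity_le_torusLogPartition r hβ L hL
  linarith

/-- **The finite-size excess is non-negative**: `0 ≤ log Z_{Λ_L,β} − L⁴ f(β)` (`L ≥ 2`, `β ≥ 0`). -/
theorem excess_nonneg (r : LatticeRep G) {β : ℝ} (hβ : 0 ≤ β) (L : ℕ) [NeZero L] (hL : 2 ≤ L) :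
    0 ≤ torusLogPartition 4 r.ρ β L - (L : ℝ) ^ 4 * freeEnergyDensity 4 r.ρ β := by
  have h := volume_mul_freeEnergyDensity_le_torusLogPartition r hβ L hL
  linarith

end Consequences

end Summit.QuantumFields.YangMills.Cruxes.IR.PressureMonotoneTM

end
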